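import Summits.Parity.GeneralizedHardyLittlewood.Theses.LiouvilleShiftedTables
import Summits.Parity.GeneralizedHardyLittlewood.Theorems.TableChowla.Negative.TableChowlaOperatorNorm

/-!
# `TableChowla` (stmt-Parity-14270): the `K`-aperiodicity proviso of the picked line's residual
# stub is void — `MeanSquareCMAperiodic ↔ MeanSquareCM`

Negative / structural lemmas for the crux `LiouvilleShiftedTables.TableChowla` (cdisprove seat,
gen 3), about the registered stubs of the PICKED line `helson-kronecker-inverse`
(`Cruxes/TableChowla/Lines/helson-kronecker-inverse.lean`). That skeleton cuts the residual
`MeanSquareCM` ("mean-square dispersion of the table against every completely multiplicative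
1-bounded column weight `g`") into `stub_periodic` (weights with a period `q ≤ (log x)^K`, the
Bombieri–Vinogradov branch) and `stub_aperiodic` (weights with NO period `q ≤ (log x)^K`, "the
two-point directions", the prover choosing `K`, "larger `K` = fewer weights").

FINDING (kernel-checked below): periodicity is not a property of `g` restricted to the columns
`b ≤ ⌊y⌋`. Every completely multiplicative 1-bounded `g ≢ 0` agrees on `[1, ⌊y⌋]` with the completely
multiplicative 1-bounded weight `g' = g · 𝟙_{p ∤ ·}` (`p` any prime `> ⌊y⌋`), and `g'` has NO period
`q < p` whatsoever (`aperiodic_killPrime`: `g'(p^{φ(q)}) = 0` while `p^{φ(q)} ≡ 1 (mod q)` and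
`g'(1) = 1`). Hence for EVERY `K`:

* `meanSquareCM_of_aperiodic : MeanSquareCMAperiodic → MeanSquareCM` and
  `meanSquareCMAperiodic_iff : MeanSquareCMAperiodic ↔ MeanSquareCM` — the aperiodic stub IS the whole
  residual (all constants, all Dirichlet characters of all conductors, all `n^{it}`-pretenders included);
* `meanSquareCMPeriodic_of_aperiodic : MeanSquareCMAperiodic → MeanSquareCMPeriodic` — the periodic
  stub (the skeleton's `stub_bv` + `stub_periodic_of_bv` branch) is logically REDUNDANT in
  `TableChowla_of`: `stubs_iff_inverse_and_aperiodic :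
  (InverseCM ∧ MeanSquareCMPeriodic ∧ MeanSquareCMAperiodic) ↔ (InverseCM ∧ MeanSquareCMAperiodic)`;
* with the skeleton's own exact splitting this reads `TableChowla ↔ InverseCM ∧ MeanSquareCMAperiodic`
  (here: `tableChowla_of_inverse_aperiodic`, re-proving the skeleton's pure-logic composition on the
  landed `Negative.OperatorNormForm`, and the converse for the inverse half,
  `inverseCM_of_tableChowla`).

So the cut "by proof technology" is NOT the intended one-point / two-point cut: as typed,
`stub_aperiodic` must still spend Siegel–Walfisz on every character direction. REPAIR (for the lead,
not a kill — every statement here is implied by the crux): cut by a LOCAL property of the weight on the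
columns, e.g. periodic branch `∃ q, 1 ≤ q ≤ (log x)^K ∧ ∃ h : ℕ → ℂ, Function.Periodic h q ∧ ∀ b ∈
[1, ⌊x/A⌋], g b = h b` (its BV proof only uses `‖g‖ ≤ 1` and periodicity ON the columns), aperiodic
branch its negation; or, matching what binary-Elliott technology consumes, by pretentious distance
`min_{cond χ ≤ (log x)^K, |t| ≤ x} 𝔻(g, χ·n^{it}; x/A)`.

The statements `MeanSquareCM`, `MeanSquareCMPeriodic`, `MeanSquareCMAperiodic`, `InverseCM` below are
VERBATIM the skeleton's (with the landed `Negative.entry`, definitionally the skeleton's `entry`).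
[folklore]
-/

namespace Summit.Parity.GeneralizedHardyLittlewood.Theorems.TableChowla.Negative

open Finset Real ArithmeticFunction
open Summit.Parity.GeneralizedHardyLittlewood.Theses

noncomputable section

/-! ## The skeleton's residual statements (verbatim) -/

/-- RESIDUAL of line `helson-kronecker-inverse` (verbatim): mean-square dispersion of the table
against completely multiplicative 1-bounded column weights. -/
def MeanSquareCM : Prop :=
  ∀ c : ℤ, c ≠ 0 → ∀ δ : ℝ, 0 < δ → δ ≤ 1 / 12 → ∀ C : ℝ, 0 < C → ∃ x₀ : ℝ, ∀ x : ℝ, x₀ ≤ x →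
    ∀ A : ℝ, x ^ δ ≤ A → A ≤ x ^ (1 / 3 + δ) →
    ∀ g : ℕ → ℂ, (∀ m n : ℕ, g (m * n) = g m * g n) → (∀ n : ℕ, ‖g n‖ ≤ 1) →
    ∀ y : ℝ, y ≤ x / A →
      ∑ a ∈ Finset.Ioc ⌊A⌋₊ ⌊2 * A⌋₊,
          ‖∑ b ∈ Finset.Icc 1 ⌊y⌋₊, g b * (entry c a b : ℂ)‖ ^ 2 ≤
        x * (x / A) / Real.log x ^ C

/-- The skeleton's `MeanSquareCMPeriodic` (= `stub_periodic`, verbatim). -/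
def MeanSquareCMPeriodic : Prop :=
  ∀ c : ℤ, c ≠ 0 → ∀ δ : ℝ, 0 < δ → δ ≤ 1 / 12 → ∀ C : ℝ, 0 < C → ∀ K : ℝ, 0 < K → ∃ x₀ : ℝ,
    ∀ x : ℝ, x₀ ≤ x → ∀ A : ℝ, x ^ δ ≤ A → A ≤ x ^ (1 / 3 + δ) →
    ∀ g : ℕ → ℂ, (∀ m n : ℕ, g (m * n) = g m * g n) → (∀ n : ℕ, ‖g n‖ ≤ 1) →
    ∀ q : ℕ, 1 ≤ q → (q : ℝ) ≤ Real.log x ^ K → Function.Periodic g q →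
    ∀ y : ℝ, y ≤ x / A →
      ∑ a ∈ Finset.Ioc ⌊A⌋₊ ⌊2 * A⌋₊,
          ‖∑ b ∈ Finset.Icc 1 ⌊y⌋₊, g b * (entry c a b : ℂ)‖ ^ 2 ≤
        x * (x / A) / Real.log x ^ C

/-- The skeleton's `MeanSquareCMAperiodic` (= `stub_aperiodic`, verbatim): the prover chooses `K`
and only treats weights with NO period `q ≤ (log x)^K`. -/
def MeanSquareCMAperiodic : Prop :=
  ∀ c : ℤ, c ≠ 0 → ∀ δ : ℝ, 0 < δ → δ ≤ 1 / 12 → ∀ C : ℝ, 0 < C → ∃ K : ℝ, 0 < K ∧ ∃ x₀ : ℝ,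
    ∀ x : ℝ, x₀ ≤ x → ∀ A : ℝ, x ^ δ ≤ A → A ≤ x ^ (1 / 3 + δ) →
    ∀ g : ℕ → ℂ, (∀ m n : ℕ, g (m * n) = g m * g n) → (∀ n : ℕ, ‖g n‖ ≤ 1) →
    (∀ q : ℕ, 1 ≤ q → (q : ℝ) ≤ Real.log x ^ K → ¬ Function.Periodic g q) →
    ∀ y : ℝ, y ≤ x / A →
      ∑ a ∈ Finset.Ioc ⌊A⌋₊ ⌊2 * A⌋₊,
          ‖∑ b ∈ Finset.Icc 1 ⌊y⌋₊, g b * (entry c a b : ℂ)‖ ^ 2 ≤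
        x * (x / A) / Real.log x ^ C

/-- The skeleton's lever `InverseCM` (= `stub_inverse`, verbatim). -/
def InverseCM : Prop :=
  ∀ c : ℤ, c ≠ 0 → ∀ δ : ℝ, 0 < δ → δ ≤ 1 / 12 → ∀ C : ℝ, 0 < C → ∃ C' : ℝ, 0 < C' ∧ ∃ x₀ : ℝ,
    ∀ x : ℝ, x₀ ≤ x → ∀ A : ℝ, x ^ δ ≤ A → A ≤ x ^ (1 / 3 + δ) →
    ∀ u v : ℕ → ℝ, (∑ a ∈ Finset.Ioc ⌊A⌋₊ ⌊2 * A⌋₊, u a ^ 2 ≤ 1) →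
      (∑ b ∈ Finset.Icc 1 ⌊x / A⌋₊, v b ^ 2 ≤ 1) →
      x ^ (1 / 2 : ℝ) / Real.log x ^ C ≤
        |∑ a ∈ Finset.Ioc ⌊A⌋₊ ⌊2 * A⌋₊, ∑ b ∈ Finset.Icc 1 ⌊x / A⌋₊, u a * v b * entry c a b| →
      ∃ g : ℕ → ℂ, (∀ m n : ℕ, g (m * n) = g m * g n) ∧ (∀ n : ℕ, ‖g n‖ ≤ 1) ∧
        ∃ y : ℝ, y ≤ x / A ∧
          x * (x / A) / Real.log x ^ C' ≤
            ∑ a ∈ Finset.Ioc ⌊A⌋₊ ⌊2 * A⌋₊,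
              ‖∑ b ∈ Finset.Icc 1 ⌊y⌋₊, g b * (entry c a b : ℂ)‖ ^ 2

/-! ## Killing one prime: an aperiodic completely multiplicative extension -/

/-- `g` with the prime `p` killed: `g' n = 0` if `p ∣ n`, else `g n`. -/
def killPrime (g : ℕ → ℂ) (p : ℕ) (n : ℕ) : ℂ := if p ∣ n then 0 else g n

/-- Off the multiples of `p` the weight is unchanged. -/
theorem killPrime_of_not_dvd {g : ℕ → ℂ} {p n : ℕ} (h : ¬ p ∣ n) : killPrime g p n = g n := by
  simp [killPrime, h]

/-- On the multiples of `p` the weight vanishes. -/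
theorem killPrime_of_dvd {g : ℕ → ℂ} {p n : ℕ} (h : p ∣ n) : killPrime g p n = 0 := by
  simp [killPrime, h]

/-- Killing a prime preserves complete multiplicativity. -/
theorem killPrime_mul {g : ℕ → ℂ} (hg : ∀ m n : ℕ, g (m * n) = g m * g n) {p : ℕ} (hp : p.Prime)
    (m n : ℕ) : killPrime g p (m * n) = killPrime g p m * killPrime g p n := by
  by_cases hm : p ∣ m
  · rw [killPrime_of_dvd (dvd_mul_of_dvd_left hm n), killPrime_of_dvd hm, zero_mul]
  by_cases hn : p ∣ n
  · rw [killPrime_of_dvd (dvd_mul_of_dvd_right hn m), killPrime_of_dvd hn, mul_zero]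
  have hmn : ¬ p ∣ m * n := fun h => (hp.dvd_mul.mp h).elim hm hn
  rw [killPrime_of_not_dvd hmn, killPrime_of_not_dvd hm, killPrime_of_not_dvd hn, hg]

/-- Killing a prime preserves 1-boundedness. -/
theorem norm_killPrime_le {g : ℕ → ℂ} (hg : ∀ n : ℕ, ‖g n‖ ≤ 1) (p n : ℕ) :
    ‖killPrime g p n‖ ≤ 1 := by
  by_cases h : p ∣ n
  · rw [killPrime_of_dvd h, norm_zero]; exact zero_le_one
  · rw [killPrime_of_not_dvd h]; exact hg n

/-- On `[1, N]` with `N < p` nothing changes. -/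
theorem killPrime_eq_on_Icc {g : ℕ → ℂ} {p N : ℕ} (hNp : N < p) {b : ℕ} (hb : b ∈ Icc 1 N) :
    killPrime g p b = g b := by
  rw [mem_Icc] at hb
  refine killPrime_of_not_dvd fun h => ?_
  have := Nat.eq_zero_of_dvd_of_lt h (lt_of_le_of_lt hb.2 hNp)
  omega

/-- APERIODICITY: if `g 1 ≠ 0` (no multiplicativity needed), then `killPrime g p` has no
period `q` with `1 ≤ q < p` (Euler: `p^{φ(q)} = 1 + m q`, so a period `q` would force
`0 = g'(p^{φ(q)}) = g'(1) = g 1`). -/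
theorem aperiodic_killPrime {g : ℕ → ℂ} (hg1 : g 1 ≠ 0)
    {p : ℕ} (hp : p.Prime) {q : ℕ} (hq1 : 1 ≤ q) (hqp : q < p) :
    ¬ Function.Periodic (killPrime g p) q := by
  intro hper
  -- `p` and `q` are coprime
  have hpq : Nat.Coprime p q := by
    refine hp.coprime_iff_not_dvd.mpr fun h => ?_
    have := Nat.le_of_dvd (by omega) h
    omega
  -- Euler: `p ^ φ(q) ≡ 1 (mod q)`, write `p ^ φ(q) = 1 + m * q`
  have heul : p ^ q.totient ≡ 1 [MOD q] := Nat.ModEq.pow_totient hpq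
  have hpow1 : 1 ≤ p ^ q.totient := Nat.one_le_pow _ _ hp.pos
  have hdvd : q ∣ p ^ q.totient - 1 := (Nat.modEq_iff_dvd' hpow1).mp heul.symm
  obtain ⟨m, hm⟩ := hdvd
  have hdecomp : p ^ q.totient = 1 + m * q := by
    have : p ^ q.totient - 1 = q * m := hm
    have h2 : p ^ q.totient = q * m + 1 := by omega
    rw [h2]; ring
  -- periodicity transported along `m * q`
  have hper' : Function.Periodic (killPrime g p) (m * q) := by
    have := hper.nat_mul m
    simpa using this
  have hval : killPrime g p (1 + m * q) = killPrime g p 1 := hper' 1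
  -- but `p ∣ p ^ φ(q)` (as `φ(q) ≥ 1`) and `p ∤ 1`
  have htot : 0 < q.totient := Nat.totient_pos.mpr (by omega)
  have hpdvd : p ∣ p ^ q.totient := dvd_pow_self p htot.ne'
  have hzero : killPrime g p (1 + m * q) = 0 := by
    rw [← hdecomp]; exact killPrime_of_dvd hpdvd
  have hone : killPrime g p 1 = g 1 := killPrime_of_not_dvd hp.not_dvd_one
  rw [hzero, hone] at hval
  exact hg1 hval.symm

/-- A completely multiplicative `g` with `g 1 = 0` vanishes identically. -/
theorem cm_eq_zero_of_map_one {g : ℕ → ℂ} (hg : ∀ m n : ℕ, g (m * n) = g m * g n) (h1 : g 1 = 0)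
    (n : ℕ) : g n = 0 := by
  have := hg 1 n
  rw [one_mul, h1, zero_mul] at this
  exact this

/-! ## The aperiodicity proviso is void -/

/-- MAIN LEMMA: for every `K`, the aperiodic residual implies the full residual. Given any CM
1-bounded `g` and `y ≤ x/A`, kill a prime `p > max(⌊y⌋, ⌊(log x)^K⌋)`: the new weight is CM,
1-bounded, has no period `≤ (log x)^K`, and gives the same column sums on `b ≤ ⌊y⌋`. -/
theorem meanSquareCM_of_aperiodic (h : MeanSquareCMAperiodic) : MeanSquareCM := by
  intro c hc δ hδ hδ' C hC
  obtain ⟨K, hK, x₀, hx₀⟩ := h c hc δ hδ hδ' C hC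
  refine ⟨max x₀ 1, ?_⟩
  intro x hx A hA hA' g hgm hgb y hy
  have hx₀' : x₀ ≤ x := le_trans (le_max_left _ _) hx
  have hx1 : (1 : ℝ) ≤ x := le_trans (le_max_right _ _) hx
  have hx0 : (0 : ℝ) ≤ x := by linarith
  have hxpos : (0 : ℝ) < x := by linarith
  have hApos : 0 < A := lt_of_lt_of_le (Real.rpow_pos_of_pos hxpos δ) hA
  have hL0 : 0 ≤ Real.log x := Real.log_nonneg hx1
  by_cases hg1 : g 1 = 0
  · -- `g ≡ 0`: the left side vanishes
    have hzero : ∀ a : ℕ, ‖∑ b ∈ Icc 1 ⌊y⌋₊, g b * (entry c a b : ℂ)‖ ^ 2 = 0 := by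
      intro a
      rw [sum_eq_zero fun b _ => by rw [cm_eq_zero_of_map_one hgm hg1 b, zero_mul], norm_zero]
      ring
    rw [sum_eq_zero fun a _ => hzero a]
    exact div_nonneg (mul_nonneg hx0 (div_nonneg hx0 hApos.le)) (Real.rpow_nonneg hL0 C)
  -- kill a prime beyond the columns and beyond `(log x)^K`
  obtain ⟨p, hpN, hp⟩ := Nat.exists_infinite_primes (max ⌊y⌋₊ ⌊Real.log x ^ K⌋₊ + 1)
  have hpy : ⌊y⌋₊ < p := by
    have := le_max_left ⌊y⌋₊ ⌊Real.log x ^ K⌋₊; omega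
  have hpK : ⌊Real.log x ^ K⌋₊ < p := by
    have := le_max_right ⌊y⌋₊ ⌊Real.log x ^ K⌋₊; omega
  have haper : ∀ q : ℕ, 1 ≤ q → (q : ℝ) ≤ Real.log x ^ K →
      ¬ Function.Periodic (killPrime g p) q := by
    intro q hq1 hqK
    have hqfloor : q ≤ ⌊Real.log x ^ K⌋₊ := (Nat.le_floor_iff (Real.rpow_nonneg hL0 K)).mpr hqK
    exact aperiodic_killPrime hg1 hp hq1 (lt_of_le_of_lt hqfloor hpK)
  have hbound := hx₀ x hx₀' A hA hA' (killPrime g p) (killPrime_mul hgm hp)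
    (norm_killPrime_le hgb p) haper y hy
  -- the column sums agree on `b ≤ ⌊y⌋ < p`
  have hsame : ∀ a : ℕ, ∑ b ∈ Icc 1 ⌊y⌋₊, killPrime g p b * (entry c a b : ℂ) =
      ∑ b ∈ Icc 1 ⌊y⌋₊, g b * (entry c a b : ℂ) := fun a =>
    sum_congr rfl fun b hb => by rw [killPrime_eq_on_Icc hpy hb]
  simp_rw [hsame] at hbound
  exact hbound

/-- … so the aperiodic stub's statement is EQUIVALENT to the full residual, for every `K`. -/
theorem meanSquareCMAperiodic_iff : MeanSquareCMAperiodic ↔ MeanSquareCM := by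
  refine ⟨meanSquareCM_of_aperiodic, fun h c hc δ hδ hδ' C hC => ?_⟩
  obtain ⟨x₀, hx₀⟩ := h c hc δ hδ hδ' C hC
  exact ⟨1, one_pos, x₀, fun x hx A hA hA' g hgm hgb _ y hy => hx₀ x hx A hA hA' g hgm hgb y hy⟩

/-- … and in particular the aperiodic stub already contains the periodic one (the BV branch
`stub_bv` + `stub_periodic_of_bv` of the skeleton is logically redundant). -/
theorem meanSquareCMPeriodic_of_aperiodic (h : MeanSquareCMAperiodic) : MeanSquareCMPeriodic := by
  intro c hc δ hδ hδ' C hC K _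
  obtain ⟨x₀, hx₀⟩ := meanSquareCM_of_aperiodic h c hc δ hδ hδ' C hC
  exact ⟨x₀, fun x hx A hA hA' g hgm hgb _ _ _ _ y hy => hx₀ x hx A hA hA' g hgm hgb y hy⟩

/-- The full residual trivially gives the periodic one. -/
theorem meanSquareCMPeriodic_of_meanSquareCM (h : MeanSquareCM) : MeanSquareCMPeriodic :=
  meanSquareCMPeriodic_of_aperiodic (meanSquareCMAperiodic_iff.mpr h)

/-- COLLAPSE OF THE SPLITTING: the skeleton's registered stub conjunction is equivalent to
`InverseCM ∧ MeanSquareCMAperiodic` — two stubs, not three. -/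
theorem stubs_iff_inverse_and_aperiodic :
    (InverseCM ∧ MeanSquareCMPeriodic ∧ MeanSquareCMAperiodic) ↔ (InverseCM ∧ MeanSquareCMAperiodic) :=
  ⟨fun h => ⟨h.1, h.2.2⟩, fun h => ⟨h.1, meanSquareCMPeriodic_of_aperiodic h.2, h.2⟩⟩

/-! ## Composition on the landed operator-norm form (pure logic, as in the skeleton) -/

/-- The dichotomy closes (skeleton's `operatorNormForm_of_inverse_msed`, on `Negative.OperatorNormForm`):
the inverse theorem at level `C` and the residual at level `C'+1` are incompatible with a
near-extremal pair of test vectors once `log x > 1`. -/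
theorem operatorNormForm_of_inverse_meanSquare (hI : InverseCM) (hM : MeanSquareCM) :
    OperatorNormForm := by
  intro c hc δ hδ hδ' C hC
  obtain ⟨C', hC', x₁, h1⟩ := hI c hc δ hδ hδ' C hC
  obtain ⟨x₂, h2⟩ := hM c hc δ hδ hδ' (C' + 1) (by linarith)
  refine ⟨max (max x₁ x₂) 3, ?_⟩
  intro x hx A hA hA' u v hu hv
  have hx₁ : x₁ ≤ x := le_trans (le_trans (le_max_left _ _) (le_max_left _ _)) hx
  have hx₂ : x₂ ≤ x := le_trans (le_trans (le_max_right _ _) (le_max_left _ _)) hx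
  have hx3 : (3 : ℝ) ≤ x := le_trans (le_max_right _ _) hx
  by_contra hlt
  push Not at hlt
  obtain ⟨g, hgm, hgb, y, hy, hbig⟩ := h1 x hx₁ A hA hA' u v hu hv hlt.le
  have hsmall := h2 x hx₂ A hA hA' g hgm hgb y hy
  have hxpos : 0 < x := by linarith
  have hApos : 0 < A := lt_of_lt_of_le (Real.rpow_pos_of_pos hxpos δ) hA
  have hnum : 0 < x * (x / A) := mul_pos hxpos (div_pos hxpos hApos)
  have hlog : 1 < Real.log x := by
    rw [Real.lt_log_iff_exp_lt hxpos]
    exact lt_of_lt_of_le (lt_trans Real.exp_one_lt_d9 (by norm_num)) hx3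
  have hLpos : 0 < Real.log x := by linarith
  have hpow : Real.log x ^ C' < Real.log x ^ (C' + 1) :=
    Real.rpow_lt_rpow_of_exponent_lt hlog (by linarith)
  have hlt' : x * (x / A) / Real.log x ^ (C' + 1) < x * (x / A) / Real.log x ^ C' :=
    div_lt_div_of_pos_left hnum (Real.rpow_pos_of_pos hLpos C') hpow
  linarith

/-- TWO stubs suffice: `InverseCM ∧ MeanSquareCMAperiodic → TableChowla` (the periodic / BV stub
is not needed). -/
theorem tableChowla_of_inverse_aperiodic (hI : InverseCM) (hA : MeanSquareCMAperiodic) :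
    LiouvilleShiftedTables.TableChowla :=
  operatorNormForm_iff.mp (operatorNormForm_of_inverse_meanSquare hI (meanSquareCM_of_aperiodic hA))

/-- Under the crux the inverse theorem holds vacuously (its premise never fires beyond `x₀`;
skeleton's `inverseCM_of_tableChowla`, via the landed `operatorNormForm_of_tableChowla`). -/
theorem inverseCM_of_tableChowla (hTC : LiouvilleShiftedTables.TableChowla) : InverseCM := by
  intro c hc δ hδ hδ' C hC
  obtain ⟨x₁, h1⟩ := operatorNormForm_of_tableChowla hTC c hc δ hδ hδ' (C + 1) (by linarith)
  refine ⟨1, one_pos, max x₁ 3, ?_⟩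
  intro x hx A hA hA' u v hu hv hbig
  exfalso
  have hx₁ : x₁ ≤ x := le_trans (le_max_left _ _) hx
  have hx3 : (3 : ℝ) ≤ x := le_trans (le_max_right _ _) hx
  have hxpos : 0 < x := by linarith
  have hsmall := h1 x hx₁ A hA hA' u v hu hv
  have hlog : 1 < Real.log x := by
    rw [Real.lt_log_iff_exp_lt hxpos]
    exact lt_of_lt_of_le (lt_trans Real.exp_one_lt_d9 (by norm_num)) hx3
  have hLpos : 0 < Real.log x := by linarith
  have hpow : Real.log x ^ C < Real.log x ^ (C + 1) :=
    Real.rpow_lt_rpow_of_exponent_lt hlog (by linarith)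
  have hnum : 0 < x ^ (1 / 2 : ℝ) := Real.rpow_pos_of_pos hxpos _
  have hlt : x ^ (1 / 2 : ℝ) / Real.log x ^ (C + 1) < x ^ (1 / 2 : ℝ) / Real.log x ^ C :=
    div_lt_div_of_pos_left hnum (Real.rpow_pos_of_pos hLpos C) hpow
  linarith

end

end Summit.Parity.GeneralizedHardyLittlewood.Theorems.TableChowla.Negative
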